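/-
Copyright (c) 2026 the pub-hodgecm-mathlib formalisation cell (harness21).  Prover seat hodgecm-mathlib-K2E3-p14 (g10) (E3 hand on strike line L1; LEAD F0P6-plan (g16)
BATCH #287 (3) design (ii); U1 desk K2E3-p28 (g4) (A) 2026-09-05T03:43:15Z «separate file»), Track B «K2-LIT» ∕ hLiu418 = `stmt-HodgeConjecture-24832`: road (R-eq) —
THE `slot_vanRes2E` CONSUMER: `resGen hex = 0` for EVERY `K_∞`-finite datum `x ∈ D_V`, from socket #41, the closure letter `hK₀`, and the dead scalar stratum, with the
generation step DISCHARGED INSIDE by ★ `hGgen_allSignatures_of_hK₀` (K2E3-p32 (g4)) at `Good := DEAD` through ★ (a) `K2LiuResidueDeadInductionLetters` (LH7-p08 (g3)).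
THEOREMS ONLY (no `def` ∕ `instance` ∕ notation ∕ named-fact hypothesis ∕ `sorry`); lane `--supports stmt-HodgeConjecture-24832 --as helper` (count-neutral).
-/
import Summits.HodgeConjecture.HodgeConjecture.Theorems.K2LiuResidueDeadInductionLetters      -- ★ (a) p865141 (LH7-p08 (g3)): `dead_congr ∕ dead_zero ∕ dead_add ∕ dead_smul ∕ dead_of_hasArchDeriv ∕ resGen_eq_zero_of_dead`
import Summits.HodgeConjecture.HodgeConjecture.Theorems.K2LiuArchWeilSectionModuleCyclicStd     -- ★ (K2E3-p32 (g4)): `hGgen_allSignatures_of_hK₀` — the generation step, every signature, modulo `hDX`, `hK₀`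
import HarnessLib

/-!
# Crux `HLiu418`, #42F′ `slot_vanRes2E`, road (R-eq): THE SLOT CONSUMER `K2LiuResidueVanishesOfDeadSubmoduleSlot` — `resGen hex = 0` on every finite-dimensional
# arch-stable rigidity domain, NO generation letter by value

Cell `hodgecm-mathlib`, crux item hLiu418 = `stmt-HodgeConjecture-24832` (helper lane, count-neutral); squad K2 ∕ E3, strike line L1, LEAD F0P6-plan (g16) RULINGS M-160j∕k,
BATCH #287 (3); U1 desk K2E3-p28 (g4); F-chain integrator K2E3-p32 (g4); (a) LH7-p08 (g3); typist K2E3-typ3 (g3) (`slot_vanRes2E`); companion ★ p865174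
`K2LiuResidueVanishesOfDeadSubmodule` (the section-level eliminator; this file is design (ii), which bypasses it).

THE POINT.  `slot_vanRes2E` asks: for the #42F′ frame at `n = 2`, a standard Iwasawa datum `𝒦`, a finite-dimensional `K_∞`-stable class `V`, `x ∈ D_V` and ANY socket-#41
continuation datum `hex` of the twisted Siegel–Weil family `g_x` — `resGen hex = 0`.  Road (R-eq) (M-160j): DEAD data («every pole-cleared continuation of `E^Δ(·; g_x)` has
normalised residue `0`», ★ FACE-G predicates `IsPoleClearedCont` ∕ `resNorm`, spelled inline) form a class closed under (congr)(zero)(add)(smul)(deriv) — ★ (a)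
`K2LiuResidueDeadInductionLetters` (socket #41 BY VALUE `h41`) — so the INDUCTION PRINCIPLE ON ADMISSIBLE DATA ★ `hGgen_allSignatures_of_hK₀` (F4-END «Std», vestigial
isotropy binders dropped; content: cyclicity of `R_σ(V′_σ)` on the Gaussian, every signature) at `Good V x := DEAD x` propagates death from the HOL-CUT DOMAINS OF RECORD (the
Gaussian ∕ scalar-`K_∞`-type stratum, BY VALUE `hbase` — the (σ-A) road's surface) to EVERY admissible datum; ★ (a) `resGen_eq_zero_of_dead` converts to the slot's currency.
BY-VALUE LETTERS OF THIS HEAD (and nothing else): `h41` (socket #41, ★ STEP 0b's bytes), `hK₀` (F4's standing closure letter — ★ `hK₀_of_signFrameAdapted … hsf` at a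
sign-frame-adapted datum, U1 desk (C) ∕ (C2′)), `hbase`.  `hDX` is DISCHARGED here at the trivial direction family `DX := ⊤` (every `X ∈ 𝔲` is a direction; (a)'s (deriv) is
undirected).  No `τ`∕definiteness binder is consumed: the engine is signature-free.
References: [KudlaRallis1994] §1 Thm. 1.1, §3; [MoeglinWaldspurger1995] IV.1.9–IV.1.11; [GanQiuTakeda2014] §3.2; [Howe1989] §3; [Liu2021] App. B Lem. B.12 pp. 103–104.
HONEST LABEL.  Count-neutral helper: `HC_CM` is proved only modulo the 7 printed citations (2 remaining named inputs: hLiu418 = `stmt-HodgeConjecture-24832`,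
h413 = `stmt-HodgeConjecture-24833`) until rung 0 closes; `slot_vanRes2E` ∕ #42F′ stay OPEN by value on `h41` (socket), `hK₀` (closure letter at the adapted class), `hbase`
(the scalar stratum's death = the (σ-A) road) — this file makes those three the slot's ENTIRE residual.
-/

set_option autoImplicit false
set_option linter.dupNamespace false -- the mandated namespace repeats `HodgeConjecture.HodgeConjecture`

noncomputable section

open scoped Matrix Topology TensorProduct SchwartzMap Classical
open NumberField NumberField.mixedEmbedding IsDedekindDomain MeasureTheory Filter
open Literature.NumberTheory.Automorphic Literature.NumberTheory.Automorphic.UnitaryGroup Literature.NumberTheory.GaloisRepresentations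
open Literature.NumberTheory.GelbartRogawski1991 Literature.NumberTheory.GelbartRogawski1991.GRConstruction
open Literature.NumberTheory.GelbartRogawski1991.GRConstruction.DoubledWeilDetTwist
open Literature.NumberTheory.GelbartRogawski1991.UnitaryDualPair
open Literature.NumberTheory.GelbartRogawski1991.UnitaryDualPair.LocalSplitting
open Literature.NumberTheory.K2Lit.SiegelDoubled
open Literature.NumberTheory.Automorphic.IdeleClassGroup
open Literature.NumberTheory.Automorphic.Liu2021
open Literature.NumberTheory.Automorphic.Liu2021.Def411WeilCarriers
open Literature.NumberTheory.Automorphic.Liu2021.Def411WeilCarriersDoubling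
open Literature.NumberTheory.Weil1964
open Literature.RepresentationTheory.Liu2021
open Literature.RepresentationTheory.HarrisKudlaSweet1996 (IsSplittingChar)
open Literature.RepresentationTheory.KonnoKonno2007.RealDualPair
open Literature.RepresentationTheory.KonnoKonno2007.RealDualPair.UForm
open Summit.HodgeConjecture.HodgeConjecture.Cruxes.HLiu418.K2LiuFirstTermResidueFormDefs (resNorm)
open Summit.HodgeConjecture.HodgeConjecture.Cruxes.HLiu418.K2LiuFirstTermResidueGenDefs
open Summit.HodgeConjecture.HodgeConjecture.Cruxes.HLiu418.K2LiuFaceGLetterDefs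
open Summit.HodgeConjecture.HodgeConjecture.Cruxes.HLiu418.K2LiuArchSectionPlaceBlock
open Summit.HodgeConjecture.HodgeConjecture.Cruxes.HLiu418.K2LiuResidueDeadInductionLetters
  (dead_congr dead_zero dead_add dead_smul dead_of_hasArchDeriv resGen_eq_zero_of_dead)
open Summit.HodgeConjecture.HodgeConjecture.Cruxes.HLiu418.K2LiuArchWeilSectionModuleCyclicStd (hGgen_allSignatures_of_hK₀)

namespace Summit.HodgeConjecture.HodgeConjecture.Cruxes.HLiu418.K2LiuResidueVanishesOfDeadSubmoduleSlot

/-- **`slot_vanRes2E` FROM SOCKET #41, THE CLOSURE LETTER AND THE DEAD SCALAR STRATUM — design (ii).**  Frame of #42F′ (`e : Fin 2 × Fin 1 ≃ Fin n`, big frame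
`dV′ : Fin 3 → L`, `χ_b` unitary splitting, `α` with `χ_b³·α̃ = λ̃⁻¹`, `𝒦` standard).  BY VALUE: `h41` = socket #41 (★ STEP 0b's bytes); `hK₀` = F4's closure letter for `𝒦`;
`hbase` = every datum of every hol-cut domain of record is DEAD (`∀ P E, IsPoleClearedCont … x₀ P E → resNorm P E = 0`).  THEN for every finite-dimensional arch-stable `V`
(the slot's `hVfd`, `hVst` bytes — `IsArchStable` unfolded) and every `x ∈ D_V`: `resGen hex = 0` for the slot's socket-#41 datum `hex` of `g_x`.  Proof: ★
`hGgen_allSignatures_of_hK₀` at `DX := ⊤`, `Good V x := DEAD x`, clauses ★ (a) `dead_congr ∕ dead_zero h41 ∕ dead_add h41 ∕ dead_smul h41 ∕ dead_of_hasArchDeriv h41`, then ★ (a)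
`resGen_eq_zero_of_dead`. [cite: KudlaRallis1994, §1 Thm. 1.1] [cite: MoeglinWaldspurger1995, IV.1.9–IV.1.11] [cite: Howe1989, §3] [cite: Liu2021, App. B Lem. B.12 pp. 103–104] -/
theorem resGen_eq_zero_slot
    (h41 : ∀ (L : Type) [Field L] [NumberField L] [IsCMField L] {n : ℕ} (e : Fin 2 × Fin 1 ≃ Fin n)
      (dV : Fin 2 → L) (hdV : ∀ i, IsCMField.complexConj L (dV i) = dV i) (hdV0 : ∀ i, dV i ≠ 0)
      (dW : Fin 1 → L) (hdW : ∀ i, IsCMField.complexConj L (dW i) = dW i) (hdW0 : ∀ i, dW i ≠ 0)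
      (lam : Literature.NumberTheory.Automorphic.IdeleClassGroup L →ₜ* Circle) (hlam : IsConjugateSymplectic L lam),
      HasWeight L lam 1 →
      ∀ (𝒦 : IwasawaDatum L e dV hdV dW hdW) (_h𝒦 : 𝒦.IsStd) (f : ℂ → HA L e dV hdV dW hdW → ℂ),
        IsStandardSectionFamily 𝒦 (toHeckeCharacter L lam⁻¹) f → (∀ s, Continuous (f s)) →
      ∃ (P : Finset ℂ) (Es : ℂ → HA L e dV hdV dW hdW → ℂ),
        (∀ h : HA L e dV hdV dW hdW, DifferentiableOn ℂ (fun s => Es s h) {s : ℂ | 0 < s.re}) ∧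
        (∀ s : ℂ, 0 < s.re → Continuous (Es s)) ∧
        (∀ s : ℂ, 0 < s.re → ∀ (γ : ratH L e dV hdV dW hdW) (h : HA L e dV hdV dW hdW),
          Es s ((γ : HA L e dV hdV dW hdW) * h) = Es s h) ∧
        (∀ (s : ℂ) (h : HA L e dV hdV dW hdW), (n : ℝ) / 2 < s.re →
          Es s h = (∏ p ∈ P, (s - p)) * eisensteinFamilyDelta L e dV hdV dW hdW f s h) ∧
        (∀ z : ℂ, 0 < z.re → ∃ C A r : ℝ, 0 < r ∧ ∀ s : ℂ, dist s z < r → ∀ h : HA L e dV hdV dW hdW,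
          ‖Es s h‖ ≤ C * adelicHeightGL (n + n) L (h : GL (Fin (n + n)) (AdeleRing (𝓞 L) L)) ^ A))
    (L : Type) [Field L] [NumberField L] [IsCMField L] {n : ℕ} (e : Fin 2 × Fin 1 ≃ Fin n)
    (dV : Fin 2 → L) (hdV : ∀ i, IsCMField.complexConj L (dV i) = dV i) (hdV0 : ∀ i, dV i ≠ 0)
    (dW : Fin 1 → L) (hdW : ∀ i, IsCMField.complexConj L (dW i) = dW i) (hdW0 : ∀ i, dW i ≠ 0)
    (lam : Literature.NumberTheory.Automorphic.IdeleClassGroup L →ₜ* Circle) (hlam : IsConjugateSymplectic L lam) (hwt : HasWeight L lam 1)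
    {M' n' : ℕ} (eW : Fin 1 × Fin 3 ≃ Fin M') (e' : Fin 2 × Fin M' ≃ Fin n')
    (dV' : Fin 3 → L) (hdV' : ∀ k, IsCMField.complexConj L (dV' k) = dV' k) (hdV'0 : ∀ k, dV' k ≠ 0)
    (χb : HeckeCharacter L) (hχbu : χb.IsUnitary) (hχbs : Literature.RepresentationTheory.HarrisKudlaSweet1996.IsSplittingChar L 1 χb)
    (α : UnitaryGroup.adelicOne (Fp L) L (IsCMField.complexConj L) →* ℂˣ) (hα : Continuous α)
    (hαrat : ∀ u : UnitaryGroup.adelicOne (Fp L) L (IsCMField.complexConj L),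
      (u : Literature.NumberTheory.GaloisRepresentations.ideleGroup L) ∈ Literature.NumberTheory.GaloisRepresentations.principalIdeles L → α u = 1)
    (hχD : χb ^ 3 * DoubledWeilDetTwist.ratioHecke L α hα hαrat = toHeckeCharacter L lam⁻¹)
    (𝒦 : IwasawaDatum L e dV hdV dW hdW) (h𝒦 : 𝒦.IsStd)
    -- ══ F4's standing closure letter `hK₀` for `𝒦`, BY VALUE (★ `hK₀_of_signFrameAdapted … hsf` at a sign-frame-adapted datum) ══
    (hK₀ : ∀ ainf : UnitaryGroup.arch (Fp L) L (IsCMField.complexConj L) (n + n) (hermD L e dV hdV dW hdW),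
      (UnitaryGroup.archToAdelic (Fp L) L (IsCMField.complexConj L) (n + n) (hermD L e dV hdV dW hdW) ainf : HA L e dV hdV dW hdW) ∈ 𝒦.K →
      ainf ∈ Submonoid.closure {k : UnitaryGroup.arch (Fp L) L (IsCMField.complexConj L) (n + n) (hermD L e dV hdV dW hdW) |
        ∃ (σ : {v : InfinitePlace (Fp L) // v.IsReal}) (k₁ : Matrix.unitaryGroup (PosIdx (signVec (cmPlaceOver L) (fun k => Sum.elim (cmGramEntry L e dV hdV dW hdW) (-cmGramEntry L e dV hdV dW hdW) ((LocalSplitting.e₂ n).symm k)) (imagUnit L) σ)) ℂ × Matrix.unitaryGroup (NegIdx (signVec (cmPlaceOver L) (fun k => Sum.elim (cmGramEntry L e dV hdV dW hdW) (-cmGramEntry L e dV hdV dW hdW) ((LocalSplitting.e₂ n).symm k)) (imagUnit L) σ)) ℂ),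
          k = (placeSec L (IsCMField.complexConj L) (n + n) (IsCMField.complexConj_ne_one L) (cmPlaceOver L) (cmPlaceOver_smul L) _
          (gramD_gram_realDiagonal_entry_ne_zero L e dV hdV dW hdW hdV0 hdW0) (complexConj_imagUnit L) (imagUnit_ne_zero L) σ
          (cmPlaceOver_comap L) (gramD_eq_diagonal_cm L e dV hdV dW hdW) (J := hermD L e dV hdV dW hdW) rfl
          (complexConj_smul_infinitePlace L) (UForm.kV _ _ k₁))})
    -- ══ (base) BY VALUE: every datum of every hol-cut domain of record is DEAD (the scalar-`K_∞`-type stratum — the (σ-A) road ∕ ★ F1) ══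
    (hbase : ∀ (V₀ : Submodule ℂ 𝓢(((Fin (n' + n')) → mixedSpace (Fp L)), ℂ)), FiniteDimensional ℂ V₀ → IsArchStable L e dV hdV hdV0 dW hdW hdW0 eW e' dV' hdV' hdV'0 χb hχbu hχbs 𝒦 V₀ →
          K2LiuArchGaussianOfRecord.holCutOfRecord L e dV hdV hdV0 dW hdW hdW0 lam hlam eW e' dV' hdV' hdV'0 χb hχbu hχbs α hα hαrat 𝒦 V₀ → ∀ x₀ : ↥(Submodule.span ℂ {x : piSchwartzBruhat (Fp L) (Fin (n' + n')) |
              ∃ a ∈ V₀, ∃ f : FinSB (Fp L) (Fin (n' + n')), x = piSchwartzBruhatEquiv (Fp L) (Fin (n' + n')) (a ⊗ₜ[ℂ] f)}), 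
          ∀ (P : Finset ℂ) (E : ℂ → HA L e dV hdV dW hdW → ℂ),
            IsPoleClearedCont L e dV hdV hdV0 dW hdW hdW0 eW e' dV' hdV' hdV'0 χb hχbu hχbs α 𝒦 (x₀ : piSchwartzBruhat (Fp L) (Fin (n' + n'))) P E → resNorm P E = 0)
    -- ══ the slot's class `V` (finite-dimensional, `K_∞`-stable: `IsArchStable` unfolded), its datum `x ∈ D_V` and socket #41's datum `hex` of `g_x` ══
    (V : Submodule ℂ 𝓢(((Fin (n' + n')) → mixedSpace (Fp L)), ℂ)) (hVfd : FiniteDimensional ℂ V)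
    (hVst : ∀ ainf : UnitaryGroup.arch (Fp L) L (IsCMField.complexConj L) (n + n) (hermD L e dV hdV dW hdW),
      (UnitaryGroup.archToAdelic (Fp L) L (IsCMField.complexConj L) (n + n) (hermD L e dV hdV dW hdW) ainf : HA L e dV hdV dW hdW) ∈ 𝒦.K →
      ∀ a ∈ V, ∃ a'' ∈ V, ∀ f : FinSB (Fp L) (Fin (n' + n')),
        adelicMpCont.omega (Fp L) (Fin (n' + n')) (gramDA L e' dV hdV (tensorFrame L dW eW dV') (tensorFrame_real L dW hdW eW dV' hdV'))
            ((doubledWeilRep L e' dV hdV hdV0 (tensorFrame L dW eW dV') (tensorFrame_real L dW hdW eW dV' hdV')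
                  (tensorFrame_ne_zero L dW eW dV' hdW0 hdV'0) χb hχbu hχbs)
              (tensorEmb L e dV hdV dW hdW eW e' dV' hdV'
                (UnitaryGroup.archToAdelic (Fp L) L (IsCMField.complexConj L) (n + n) (hermD L e dV hdV dW hdW) ainf)))
            (piSchwartzBruhatEquiv (Fp L) (Fin (n' + n')) (a ⊗ₜ[ℂ] f)) =
          piSchwartzBruhatEquiv (Fp L) (Fin (n' + n')) (a'' ⊗ₜ[ℂ] f))
    (x : ↥(Submodule.span ℂ {x : piSchwartzBruhat (Fp L) (Fin (n' + n')) |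
        ∃ a ∈ V, ∃ f : FinSB (Fp L) (Fin (n' + n')), x = piSchwartzBruhatEquiv (Fp L) (Fin (n' + n')) (a ⊗ₜ[ℂ] f)}))
    (hex : ∃ (P : Finset ℂ) (Es : ℂ → HA L e dV hdV dW hdW → ℂ),
      (∀ h : HA L e dV hdV dW hdW, DifferentiableOn ℂ (fun s => Es s h) {s : ℂ | 0 < s.re}) ∧
      (∀ s : ℂ, 0 < s.re → Continuous (Es s)) ∧
      (∀ s : ℂ, 0 < s.re → ∀ (γ : ratH L e dV hdV dW hdW) (h : HA L e dV hdV dW hdW),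
        Es s ((γ : HA L e dV hdV dW hdW) * h) = Es s h) ∧
      (∀ (s : ℂ) (h : HA L e dV hdV dW hdW), (n : ℝ) / 2 < s.re →
        Es s h = (∏ p ∈ P, (s - p)) * eisensteinFamilyDelta L e dV hdV dW hdW
          (fun s₁ h₁ => ((DoubledWeilDetTwist.detChar L e dV hdV hdV0 dW hdW hdW0 α h₁ : ℂˣ) : ℂ) *
            stdExtension 𝒦 ((((3 : ℕ) : ℂ) - (n : ℂ)) / 2)
              (swSectionTensor L e dV hdV dW hdW eW e' dV' hdV' hdV0 hdW0 hdV'0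
                (doubledWeilRep L e' dV hdV hdV0 (tensorFrame L dW eW dV') (tensorFrame_real L dW hdW eW dV' hdV')
                  (tensorFrame_ne_zero L dW eW dV' hdW0 hdV'0) χb hχbu hχbs)
                (x : piSchwartzBruhat (Fp L) (Fin (n' + n')))) s₁ h₁) s h) ∧
      (∀ z : ℂ, 0 < z.re → ∃ C A r : ℝ, 0 < r ∧ ∀ s : ℂ, dist s z < r → ∀ h : HA L e dV hdV dW hdW,
        ‖Es s h‖ ≤ C * adelicHeightGL (n + n) L (h : GL (Fin (n + n)) (AdeleRing (𝓞 L) L)) ^ A)) :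
    resGen hex = 0 := by
  letI : LieRing (Matrix (Fin 2 ⊕ Fin 2) (Fin 2 ⊕ Fin 2) ℂ) := LieRing.ofAssociativeRing  -- `𝔲(2,2)` (as the engine)
  refine resGen_eq_zero_of_dead L e dV hdV hdV0 dW hdW hdW0 eW e' dV' hdV' hdV'0 χb hχbu hχbs α 𝒦 V x ?_ hex
  exact hGgen_allSignatures_of_hK₀ (@fun _ _ _ _ _ _ _ _ _ _ _ => True) L e dV hdV hdV0 dW hdW hdW0 lam hlam hwt eW e' dV' hdV' hdV'0 χb hχbu hχbs
    α hα hαrat hχD 𝒦 h𝒦 (fun _ _ _ _ _ _ _ _ => trivial) hK₀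
    (fun V x => ∀ (P : Finset ℂ) (E : ℂ → HA L e dV hdV dW hdW → ℂ),
      IsPoleClearedCont L e dV hdV hdV0 dW hdW hdW0 eW e' dV' hdV' hdV'0 χb hχbu hχbs α 𝒦 (x : piSchwartzBruhat (Fp L) (Fin (n' + n'))) P E → resNorm P E = 0)
    hbase
    (fun V V' x x' hgg hGx => dead_congr L e dV hdV hdV0 dW hdW hdW0 eW e' dV' hdV' hdV'0 χb hχbu hχbs α 𝒦 V V' x x' hgg hGx)
    (dead_zero h41 L e dV hdV hdV0 dW hdW hdW0 lam hlam hwt eW e' dV' hdV' hdV'0 χb hχbu hχbs α hα hαrat hχD 𝒦 h𝒦)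
    (dead_add h41 L e dV hdV hdV0 dW hdW hdW0 lam hlam hwt eW e' dV' hdV' hdV'0 χb hχbu hχbs α hα hαrat hχD 𝒦 h𝒦)
    (dead_smul h41 L e dV hdV hdV0 dW hdW hdW0 lam hlam hwt eW e' dV' hdV' hdV'0 χb hχbu hχbs α hα hαrat hχD 𝒦 h𝒦)
    (fun V hVfd harch x hGx X hX _ V' hV'fd harch' x' hD =>
      dead_of_hasArchDeriv h41 L e dV hdV hdV0 dW hdW hdW0 lam hlam hwt eW e' dV' hdV' hdV'0 χb hχbu hχbs α hα hαrat hχD 𝒦 h𝒦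
        V hVfd harch x hGx X hX V' hV'fd harch' x' hD)
    V hVfd hVst x

end Summit.HodgeConjecture.HodgeConjecture.Cruxes.HLiu418.K2LiuResidueVanishesOfDeadSubmoduleSlot

end
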